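import Summits.SmoothPoincare4.SmoothPoincare4.Theses.SymplecticCap
import Literature.Geometry.Symplectic.JSphereLocalFoliationFromTransverseFamily
import Summits.SmoothPoincare4.SmoothPoincare4.Theorems.SullivanDualWitnessChargeDeformationFamily
import Summits.SmoothPoincare4.SmoothPoincare4.Theorems.SymplecticCapLocalFoliationEmbeddedSpheresStubNormalVelocityDichotomy
import Summits.SmoothPoincare4.SmoothPoincare4.Theorems.SymplecticOrigamiGromovRecognitionRelEndHelperImmersionCriterion

/-!
# `LocalFoliationEmbeddedSpheres` (stmt-SmoothPoincare4-16778) — the Hofer–Lizan–Sikorav local foliation fact, closed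

The second of the three `J`-curve fact cruxes to which `GromovRecognitionRelEnd`
(stmt-SmoothPoincare4-11009, line `cross-cap-laurent`) is reduced
(`GromovRecognitionRelEnd_of_three`). The route decl
`Summit.SmoothPoincare4.SmoothPoincare4.Theses.SymplecticCap.LocalFoliationEmbeddedSpheres` is, verbatim,
the Literature named fact `Literature.Geometry.Symplectic.hls_localFoliation_embeddedSphere_trivialNormal`
(Wendl 2018 Prop. 2.53, `m = 0`; Hofer–Lizan–Sikorav 1997 Thm. 1): an embedded `J`-holomorphic two-chart
sphere with trivial normal bundle in an almost complex 4-manifold is a leaf of a local foliation by such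
spheres, unique near the central leaf.

This file is the birth skeleton `Cruxes/GromovRecognitionRelEnd/SplitLocalFoliationBirth.lean` with its three
registered stubs replaced by the landed theorems:

* stub A `stub_deformationFamily` — `…Theorems.WitnessCharge.PencilIncompleteness.stub_deformationFamily`
  (crux `WitnessCharge` chain: the chart-level analytic core `SphereACData.coreFor` — implicit function theorem in
  Hölder section spaces over `S²`, bordered linearisation `[[2∂̄_T, M], [0, 2∂̄ + A]]`, elliptic bootstrapping —
  composed with the manifold-side packaging `helper_deformationFamily_of_core`);
* stub B `stub_normalVelocityDichotomy` — `…Theorems.LocalFoliationEmbeddedSpheres.stub_normalVelocityDichotomy`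
  (lead c6 of this chain: similarity principle + total index `0` on the sphere);
* stub C `stub_immersionCriterion` — `…Theorems.GromovRecognitionRelEnd.CrossCapLaurent.helper_immersionCriterion`
  (lead c5: manifold chain rule through `πN`).

The composition is the kernel-checked glue of the birth file (effective family + dichotomy ⇒ pointwise injective
normal velocities ⇒ immersive evaluation map) followed by the landed reduction
`hls_localFoliation_embeddedSphere_trivialNormal_of_transverseFamily` (openness of the sweep, embeddedness and
disjointness of nearby leaves, uniqueness by positivity of intersections).

## References

* C. Wendl, *Holomorphic Curves in Low Dimensions*, LNM 2216 (2018), Thm. 2.46, Prop. 2.53. [Wendl2018]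
* H. Hofer, V. Lizan, J.-C. Sikorav, *On genericity for holomorphic curves in four-dimensional almost-complex
  manifolds*, J. Geom. Anal. 7 (1997) 149–159, Thm. 1. [HoferLizanSikorav1997]
-/

open scoped Manifold ContDiff Topology
open Set Function Literature.Topology.FourManifolds Literature.Topology.FourManifolds.ComplexProjectiveSpace
open Literature.Geometry.Symplectic

namespace Summit.SmoothPoincare4.SmoothPoincare4.Theorems

/-- **The Hofer–Lizan–Sikorav local foliation fact, route form** (closes stmt-SmoothPoincare4-16778):
`SymplecticCap.LocalFoliationEmbeddedSpheres`, from the three landed birth stubs (deformation family,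
normal velocity dichotomy, immersion criterion) through the landed reduction
`hls_localFoliation_embeddedSphere_trivialNormal_of_transverseFamily`. -/
theorem LocalFoliationEmbeddedSpheres_proof :
    Summit.SmoothPoincare4.SmoothPoincare4.Theses.SymplecticCap.LocalFoliationEmbeddedSpheres := by
  refine hls_localFoliation_embeddedSphere_trivialNormal_of_transverseFamily ?_
  intro X _ _ _ _ _ JX u₀ v₀ N πN hu₀ hv₀ huv₀ hJu₀ hJv₀ hinj himm₀ himmv hnot hN hsub hπ hπs hzero
  obtain ⟨ε, U, V, hε, hU0, hV0, hleaf, hUs, hVs, heff⟩ :=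
    WitnessCharge.PencilIncompleteness.stub_deformationFamily X JX u₀ v₀ N πN hu₀ hv₀ huv₀ hJu₀ hJv₀
      hinj himm₀ himmv hnot hN hsub hπ hπs hzero
  have hdich := LocalFoliationEmbeddedSpheres.stub_normalVelocityDichotomy X JX u₀ v₀ N πN hu₀ hv₀
    huv₀ hJu₀ hJv₀ hinj himm₀ himmv hnot hN hsub hπ hπs hzero ε U V hε hU0 hV0 hleaf hUs hVs
  -- effective + dichotomy ⇒ every directional normal velocity is nowhere zero
  have hnz : ∀ c : ℂ, c ≠ 0 →
      (∀ z, (fderiv ℝ (fun a : ℂ => πN (U a z)) 0) c ≠ 0) ∧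
        (∀ w, (fderiv ℝ (fun a : ℂ => πN (V a w)) 0) c ≠ 0) := by
    intro c hc
    rcases hdich c with ⟨hzU, hzV⟩ | h
    · rcases heff c hc with ⟨z', hz'⟩ | ⟨w', hw'⟩
      · exact absurd (hzU z') hz'
      · exact absurd (hzV w') hw'
    · exact h
  have hDU : ∀ z, Injective (fderiv ℝ (fun a : ℂ => πN (U a z)) 0) := by
    intro z
    refine (injective_iff_map_eq_zero _).2 fun c hc0 => ?_
    by_contra hc
    exact (hnz c hc).1 z hc0
  have hDV : ∀ w, Injective (fderiv ℝ (fun a : ℂ => πN (V a w)) 0) := by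
    intro w
    refine (injective_iff_map_eq_zero _).2 fun c hc0 => ?_
    by_contra hc
    exact (hnz c hc).2 w hc0
  obtain ⟨himmU, himmV⟩ :=
    GromovRecognitionRelEnd.CrossCapLaurent.helper_immersionCriterion X JX u₀ v₀ N πN hu₀ hv₀ huv₀
      hJu₀ hJv₀ hinj himm₀ himmv hnot hN hsub hπ hπs hzero ε U V hε hU0 hV0 hleaf hUs hVs hDU hDV
  exact ⟨ε, U, V, hε, hU0, hV0, hleaf, hUs, hVs, himmU, himmV⟩

/-- **The Literature named fact `hls_localFoliation_embeddedSphere_trivialNormal` holds** (Wendl 2018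
Prop. 2.53, `m = 0`; Hofer–Lizan–Sikorav 1997 Thm. 1): the route decl is this constant, definitionally. -/
theorem hls_localFoliation_embeddedSphere_trivialNormal_holds :
    hls_localFoliation_embeddedSphere_trivialNormal :=
  LocalFoliationEmbeddedSpheres_proof

end Summit.SmoothPoincare4.SmoothPoincare4.Theorems
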